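import Mathlib.LinearAlgebra.Finsupp.LinearCombination
import Mathlib.LinearAlgebra.Pi
import Mathlib.LinearAlgebra.Quotient.Basic
import Mathlib.LinearAlgebra.Dimension.Finrank
import Mathlib.Algebra.BigOperators.Pi
import Mathlib.Algebra.Homology.HomologicalComplex
import Mathlib.Algebra.Category.ModuleCat.Basic
import Mathlib.Data.ZMod.Basic
import Mathlib.Data.Finset.Prod
import HarnessLib

/-!
# The cubical cell structure of the discrete torus `(ℤ/N)^n` and its cellular chain complex

Topic `Literature/AlgebraicTopology/CellComplexes`, namespace
`Literature.AlgebraicTopology.CellComplexes.CubicalTorus`.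

The torus `T^n = (ℝ/Nℤ)^n` (`N ≥ 1`) carries the product CW structure whose factors are the
`N`-gon structures on the circle `ℝ/Nℤ` (vertices `ℤ/N`, edges `[a, a+1]`). Its cells are the cubes
`v + [0,1]^S` for a base vertex `v ∈ (ℤ/N)^n` and a set `S ⊆ {0,…,n-1}` of free directions; the
dimension of `(v, S)` is `|S|`, and its codimension-one faces are, for `i ∈ S`, the *back face*
`(v, S ∖ i)` and the *front face* `(v + eᵢ, S ∖ i)`. With the product orientations the cellular
boundary is (Hatcher, Prop. 3B.1, `d(eⁱ × eʲ) = deⁱ × eʲ + (-1)ⁱ eⁱ × deʲ`, iterated over the `n`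
factors)

  `∂ (v, S) = ∑_{i ∈ S} (-1)^{#{j ∈ S | j < i}} ( (v + eᵢ, S ∖ i) - (v, S ∖ i) )`.

This file is purely combinatorial/algebraic (no topological spaces):

* `CubicalTorus.Cell N n = (Fin n → ZMod N) × Finset (Fin n)`, `Cell.dim`, `Cell.back`,
  `Cell.front`, `Cell.facets`; for `1 < N` a `k`-cell has exactly `2k` facets (`Cell.card_facets`)
  and the incidence numbers `[∂c : c']` are `±1` on facets and `0` elsewhere
  (`boundary_single_apply_back/front`, `boundary_single_apply_eq_zero`): the complex is regular.
* `CubicalTorus.Chain N n R = Cell N n → R` (`[NeZero N]`, so that the cells form a finite type),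
  the free `R`-module on the cells, all degrees at once, `R` any commutative ring; the `k`-chains
  are the submodule `degree N n R k` of chains supported on `k`-cells; the cell `c` is the chain
  `Pi.single c 1`. `boundary N n R : Chain →ₗ Chain` is the linear extension of the displayed
  formula (`cellBoundary`, `boundary_single`); it lowers the degree by one (`boundary_mem_degree`)
  and `boundary ∘ boundary = 0` (`boundary_mul_boundary`). The proof factors `∂ = ∑ᵢ (Tᵢ - 1) ∘ πᵢ`
  through the translations `shift i` and the signed contractions `face i`, which anticommute.
* the graded pieces `boundaryMap N n R k : degree (k+1) →ₗ[R] degree k` and the bundled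
  `cubicalTorusComplex N n R : ChainComplex (ModuleCat R) ℕ`;
* `cycles`, `boundaries`, the cellular homology `homology N n R k = Z_k / B_k` and the Betti
  numbers `bettiNumber N n R k = finrank_R H_k`;
* cell count: there are `N^n · C(n,k)` cells of dimension `k` (`card_filter_dim_eq`).

The homology computation `H_k ≅ R^{C(n,k)}` (Hatcher §3.B; §3.3, p. 230 for `T^n`), hence
`bettiNumber N n R k = C(n,k)` and `∑_k bettiNumber = 2^n`, is the companion file
`CubicalTorusHomology.lean`.

Design: cells of all dimensions live in one finite type and chains of all degrees in one module,
the grading being the family of submodules `degree k`; the boundary is then a single linear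
endomorphism and the Koszul-sign bookkeeping is uniform. Chains are plain functions on the finite
type of cells (rather than `Finsupp`), which keeps the instance paths of `Module.End R (Chain …)`
transparent to `rw`/`simp`. Not here: the geometric realisation as a CW complex on `(ℝ/Nℤ)^n` and
the comparison with singular homology (Mathlib has no cellular homology of CW complexes at the
pin).

## References

* A. Hatcher, *Algebraic Topology*, CUP (2002): §3.B, Prop. 3B.1 (boundary in a product CW
  complex); §2.2 (cellular chain complexes); §3.3, p. 230 (`H_k(Tⁿ) ≅ ℤ^{C(n,k)}`).
  [HatcherAT2002]
-/

noncomputable section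

open Finset

namespace Literature.AlgebraicTopology.CellComplexes

namespace CubicalTorus

variable {N n : ℕ}

/-- A **cell of the cubical torus** `(ℤ/N)^n`: a base vertex `v : Fin n → ZMod N` and a set `S` of
free directions; it stands for the cube `v + [0,1]^S` of dimension `|S|`.
[cite: HatcherAT2002, §3.B Prop. 3B.1 (product cells)] -/
abbrev Cell (N n : ℕ) : Type := (Fin n → ZMod N) × Finset (Fin n)

namespace Cell

/-- The dimension of a cell: its number of free directions. [folklore] -/
def dim (c : Cell N n) : ℕ := c.2.card

/-- Unfolding `dim`. [folklore] -/
theorem dim_def (c : Cell N n) : c.dim = c.2.card := rfl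

/-- The **back face** of `(v, S)` in direction `i`: `(v, S ∖ i)`. [folklore] -/
def back (c : Cell N n) (i : Fin n) : Cell N n := (c.1, c.2.erase i)

/-- The **front face** of `(v, S)` in direction `i`: `(v + eᵢ, S ∖ i)`. [folklore] -/
def front (c : Cell N n) (i : Fin n) : Cell N n := (c.1 + Pi.single i 1, c.2.erase i)

/-- Base vertex of the back face. [folklore] -/
@[simp] theorem back_fst (c : Cell N n) (i : Fin n) : (c.back i).1 = c.1 := rfl

/-- Directions of the back face. [folklore] -/
@[simp] theorem back_snd (c : Cell N n) (i : Fin n) : (c.back i).2 = c.2.erase i := rfl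

/-- Base vertex of the front face. [folklore] -/
@[simp] theorem front_fst (c : Cell N n) (i : Fin n) : (c.front i).1 = c.1 + Pi.single i 1 := rfl

/-- Directions of the front face. [folklore] -/
@[simp] theorem front_snd (c : Cell N n) (i : Fin n) : (c.front i).2 = c.2.erase i := rfl

/-- A back face in a free direction has one dimension less. [folklore] -/
theorem dim_back_add_one (c : Cell N n) {i : Fin n} (h : i ∈ c.2) : (c.back i).dim + 1 = c.dim :=
  Finset.card_erase_add_one h

/-- A front face in a free direction has one dimension less. [folklore] -/
theorem dim_front_add_one (c : Cell N n) {i : Fin n} (h : i ∈ c.2) :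
    (c.front i).dim + 1 = c.dim :=
  Finset.card_erase_add_one h

/-- The **facets** (codimension-one faces) of a cell: its back and front faces in the free
directions. [folklore] -/
def facets (c : Cell N n) : Finset (Cell N n) := c.2.biUnion fun i => {c.back i, c.front i}

/-- Membership in `facets`. [folklore] -/
theorem mem_facets {c c' : Cell N n} :
    c' ∈ c.facets ↔ ∃ i ∈ c.2, c' = c.back i ∨ c' = c.front i := by
  simp [facets]

/-- Back faces are facets. [folklore] -/
theorem back_mem_facets (c : Cell N n) {i : Fin n} (h : i ∈ c.2) : c.back i ∈ c.facets :=
  mem_facets.2 ⟨i, h, Or.inl rfl⟩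

/-- Front faces are facets. [folklore] -/
theorem front_mem_facets (c : Cell N n) {i : Fin n} (h : i ∈ c.2) : c.front i ∈ c.facets :=
  mem_facets.2 ⟨i, h, Or.inr rfl⟩

/-- Facets have one dimension less. [folklore] -/
theorem dim_add_one_of_mem_facets {c c' : Cell N n} (h : c' ∈ c.facets) : c'.dim + 1 = c.dim := by
  obtain ⟨i, hi, rfl | rfl⟩ := mem_facets.1 h
  exacts [c.dim_back_add_one hi, c.dim_front_add_one hi]

/-- Back faces in distinct free directions are distinct. [folklore] -/
theorem back_eq_back_iff (c : Cell N n) {i j : Fin n} (hi : i ∈ c.2) :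
    c.back i = c.back j ↔ i = j :=
  ⟨fun h => (Finset.erase_inj c.2 hi).1 (congrArg Prod.snd h), fun h => h ▸ rfl⟩

/-- Front faces in distinct free directions are distinct. [folklore] -/
theorem front_eq_front_iff (c : Cell N n) {i j : Fin n} (hi : i ∈ c.2) :
    c.front i = c.front j ↔ i = j :=
  ⟨fun h => (Finset.erase_inj c.2 hi).1 (congrArg Prod.snd h), fun h => h ▸ rfl⟩

/-- For `1 < N` back faces and front faces differ (for `N = 1` they coincide: the structure is the
minimal, non-regular one). [folklore] -/
theorem back_ne_front [Fact (1 < N)] (c : Cell N n) (i j : Fin n) (hi : i ∈ c.2) :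
    c.back i ≠ c.front j := by
  intro h
  by_cases hij : i = j
  · subst hij
    have h1 := congrArg (fun c : Cell N n => c.1 i) h
    simp [back, front] at h1
  · exact hij ((Finset.erase_inj c.2 hi).1 (congrArg Prod.snd h))

/-- **Regularity count**: for `1 < N` a cell of dimension `k` has exactly `2k` facets.
[folklore] -/
theorem card_facets [Fact (1 < N)] (c : Cell N n) : c.facets.card = 2 * c.dim := by
  rw [facets, Finset.card_biUnion, Finset.sum_const_nat (m := 2) fun i hi => ?_, mul_comm, dim]
  · exact Finset.card_pair (c.back_ne_front i i hi)
  · intro i hi j hj hij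
    change Disjoint ({c.back i, c.front i} : Finset (Cell N n)) {c.back j, c.front j}
    rw [Finset.disjoint_left]
    intro x hx hx'
    simp only [Finset.mem_insert, Finset.mem_singleton] at hx hx'
    have h2 : x.2 = c.2.erase i := by rcases hx with rfl | rfl <;> rfl
    have h3 : x.2 = c.2.erase j := by rcases hx' with rfl | rfl <;> rfl
    exact hij ((Finset.erase_inj c.2 hi).1 (h2.symm.trans h3))

end Cell

/-! ### Koszul signs -/

/-- The number of free directions of `S` strictly below `i`; the cellular boundary carries the
sign `(-1) ^ below S i` on the faces in direction `i` (iterated product orientation).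
[cite: HatcherAT2002, §3.B Prop. 3B.1] -/
def below (S : Finset (Fin n)) (i : Fin n) : ℕ := (S.filter (· < i)).card

/-- Erasing a direction not below `i` does not change `below S i`. [folklore] -/
theorem below_erase_of_not_lt {S : Finset (Fin n)} {i j : Fin n} (h : ¬ j < i) :
    below (S.erase j) i = below S i := by
  unfold below
  rw [Finset.filter_erase, Finset.erase_eq_of_notMem]
  simp [h]

/-- Erasing a free direction below `i` lowers `below S i` by one. [folklore] -/
theorem below_erase_add_one {S : Finset (Fin n)} {i j : Fin n} (hj : j ∈ S) (h : j < i) :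
    below (S.erase j) i + 1 = below S i := by
  unfold below
  rw [Finset.filter_erase, Finset.card_erase_add_one]
  exact Finset.mem_filter.2 ⟨hj, h⟩

/-- Inserting a direction not below `j` does not change `below S j`. [folklore] -/
theorem below_insert_of_not_lt {S : Finset (Fin n)} {i j : Fin n} (h : ¬ i < j) :
    below (insert i S) j = below S j := by
  unfold below
  rw [Finset.filter_insert, if_neg h]

/-- Inserting a new direction below `j` raises `below S j` by one. [folklore] -/
theorem below_insert_of_lt {S : Finset (Fin n)} {i j : Fin n} (hi : i ∉ S) (h : i < j) :
    below (insert i S) j = below S j + 1 := by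
  unfold below
  rw [Finset.filter_insert, if_pos h, Finset.card_insert_of_notMem]
  simp [hi]

section Ring

variable (R : Type*) [CommRing R]

/-- The **Koszul sign** `(-1)^{#{j ∈ S | j < i}}` with which the faces in direction `i` of a cell
with free directions `S` enter its boundary. [cite: HatcherAT2002, §3.B Prop. 3B.1] -/
def sgn (S : Finset (Fin n)) (i : Fin n) : R := (-1) ^ below S i

variable {R}

/-- `sgn² = 1`. [folklore] -/
@[simp] theorem sgn_mul_self (S : Finset (Fin n)) (i : Fin n) : sgn R S i * sgn R S i = 1 := by
  rw [sgn, ← pow_add, ← two_mul, pow_mul, neg_one_sq, one_pow]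

/-- `sgn² = 1`, inside a product. [folklore] -/
@[simp] theorem sgn_mul_sgn_mul (S : Finset (Fin n)) (i : Fin n) (r : R) :
    sgn R S i * (sgn R S i * r) = r := by
  rw [← mul_assoc, sgn_mul_self, one_mul]

/-- Erasing a direction not below `i` keeps the sign. [folklore] -/
theorem sgn_erase_of_not_lt {S : Finset (Fin n)} {i j : Fin n} (h : ¬ j < i) :
    sgn R (S.erase j) i = sgn R S i := by
  rw [sgn, sgn, below_erase_of_not_lt h]

/-- Erasing a free direction below `i` flips the sign. [folklore] -/
theorem sgn_erase_of_lt {S : Finset (Fin n)} {i j : Fin n} (hj : j ∈ S) (h : j < i) :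
    sgn R (S.erase j) i = -sgn R S i := by
  rw [sgn, sgn, ← below_erase_add_one hj h, pow_succ, mul_neg_one, neg_neg]

/-- Inserting a direction not below `j` keeps the sign. [folklore] -/
theorem sgn_insert_of_not_lt {S : Finset (Fin n)} {i j : Fin n} (h : ¬ i < j) :
    sgn R (insert i S) j = sgn R S j := by
  rw [sgn, sgn, below_insert_of_not_lt h]

/-- Inserting a new direction below `j` flips the sign. [folklore] -/
theorem sgn_insert_of_lt {S : Finset (Fin n)} {i j : Fin n} (hi : i ∉ S) (h : i < j) :
    sgn R (insert i S) j = -sgn R S j := by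
  rw [sgn, sgn, below_insert_of_lt hi h, pow_succ, mul_neg_one]

/-! ### Chains and the boundary -/

variable [NeZero N]

/-- The **cellular chains** of the cubical torus `(ℤ/N)^n` with coefficients in `R`: the free
`R`-module of functions on the (finitely many) cells, all degrees at once; the cell `c` is the
chain `Pi.single c 1`, the `k`-chains are the submodule `degree N n R k`.
[cite: HatcherAT2002, §2.2 (cellular chain complex)] -/
abbrev Chain (N n : ℕ) (R : Type*) [CommRing R] : Type _ := Cell N n → R

omit [NeZero N] in
/-- `r • Pi.single c s = Pi.single c (r * s)` in the chains. [folklore] -/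
theorem smul_single (c : Cell N n) (r s : R) :
    r • (Pi.single c s : Chain N n R) = Pi.single c (r * s) := by
  rw [← Pi.single_smul', smul_eq_mul]

omit [NeZero N] in
/-- `r • c = Pi.single c r` for a cell `c`. [folklore] -/
theorem smul_single_one (c : Cell N n) (r : R) :
    r • (Pi.single c (1 : R) : Chain N n R) = Pi.single c r := by
  rw [smul_single, mul_one]

variable (R) in
/-- The linear endomorphism of the chains with prescribed values on the cells. [folklore] -/
def onCells (f : Cell N n → Chain N n R) : Module.End R (Chain N n R) :=
  Fintype.linearCombination R f

/-- `onCells f` on a cell. [folklore] -/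
@[simp] theorem onCells_single (f : Cell N n → Chain N n R) (c : Cell N n) (r : R) :
    onCells R f (Pi.single c r) = r • f c := by
  simp [onCells, Fintype.linearCombination_apply_single]

/-- Linear maps out of the chains are determined by their values on cells. [folklore] -/
theorem hom_ext {M : Type*} [AddCommGroup M] [Module R M] {f g : Chain N n R →ₗ[R] M}
    (h : ∀ c : Cell N n, f (Pi.single c 1) = g (Pi.single c 1)) : f = g :=
  LinearMap.pi_ext' fun c => LinearMap.ext_ring (h c)

variable (R) in
/-- The **boundary of a cell**:
`∂ (v, S) = ∑_{i ∈ S} (-1)^{#{j ∈ S | j < i}} ((v + eᵢ, S ∖ i) - (v, S ∖ i))`.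
[cite: HatcherAT2002, §3.B Prop. 3B.1] -/
def cellBoundary (c : Cell N n) : Chain N n R :=
  ∑ i ∈ c.2, sgn R c.2 i • ((Pi.single (c.front i) 1 : Chain N n R) - Pi.single (c.back i) 1)

omit [NeZero N] in
/-- `cellBoundary` with the signs as coefficients. [folklore] -/
theorem cellBoundary_eq (c : Cell N n) :
    cellBoundary R c =
      ∑ i ∈ c.2, ((Pi.single (c.front i) (sgn R c.2 i) : Chain N n R) -
        Pi.single (c.back i) (sgn R c.2 i)) := by
  simp only [cellBoundary, smul_sub, smul_single_one]

variable (N n R)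

/-- The **cellular boundary** `∂ : C → C` of the cubical torus, the linear extension of
`cellBoundary`. [cite: HatcherAT2002, §3.B Prop. 3B.1] -/
def boundary : Module.End R (Chain N n R) := onCells R (cellBoundary R)

/-- Translation of the base vertex by `eᵢ`: `(v, S) ↦ (v + eᵢ, S)`. [folklore] -/
def shift (i : Fin n) : Module.End R (Chain N n R) :=
  onCells R fun c => Pi.single (c.1 + Pi.single i 1, c.2) 1

/-- The signed contraction of the direction `i`: `(v, S) ↦ (-1)^{below S i} (v, S ∖ i)` if
`i ∈ S`, and `0` otherwise. [folklore] -/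
def face (i : Fin n) : Module.End R (Chain N n R) :=
  onCells R fun c => if i ∈ c.2 then sgn R c.2 i • Pi.single (c.1, c.2.erase i) 1 else 0

/-- The part of the boundary in direction `i`: `∂ᵢ = (shift i - 1) ∘ face i`. [folklore] -/
def dOp (i : Fin n) : Module.End R (Chain N n R) := (shift N n R i - 1) * face N n R i

variable {N n R}

/-- The boundary of a cell is `cellBoundary`. [folklore] -/
@[simp] theorem boundary_single (c : Cell N n) :
    boundary N n R (Pi.single c 1) = cellBoundary R c := by
  simp [boundary]

/-- `shift` on a cell. [folklore] -/
@[simp] theorem shift_single (i : Fin n) (c : Cell N n) (r : R) :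
    shift N n R i (Pi.single c r) = Pi.single (c.1 + Pi.single i 1, c.2) r := by
  simp [shift, smul_single_one]

/-- `face` on a cell. [folklore] -/
@[simp] theorem face_single (i : Fin n) (c : Cell N n) (r : R) :
    face N n R i (Pi.single c r) =
      if i ∈ c.2 then Pi.single (c.1, c.2.erase i) (sgn R c.2 i * r) else 0 := by
  by_cases h : i ∈ c.2
  · simp [face, h, smul_single, mul_comm]
  · simp [face, h]

/-- `dOp i` on a cell: the two faces in direction `i`, with their signs. [folklore] -/
theorem dOp_single (i : Fin n) (c : Cell N n) (r : R) :
    dOp N n R i (Pi.single c r) =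
      if i ∈ c.2 then
        (Pi.single (c.front i) (sgn R c.2 i * r) : Chain N n R) -
          Pi.single (c.back i) (sgn R c.2 i * r) else 0 := by
  by_cases h : i ∈ c.2
  · simp [dOp, h, Cell.front, Cell.back, LinearMap.sub_apply]
  · simp [dOp, h]

/-- `∂ = ∑ᵢ ∂ᵢ`. [folklore] -/
theorem boundary_eq_sum_dOp : boundary N n R = ∑ i, dOp N n R i := by
  refine hom_ext fun c => ?_
  rw [boundary_single, cellBoundary_eq, LinearMap.sum_apply]
  simp_rw [dOp_single, mul_one]
  rw [← Finset.sum_filter, Finset.filter_univ_mem]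

/-- `face i ∘ face i = 0`. [folklore] -/
theorem face_mul_face_self (i : Fin n) : face N n R i * face N n R i = 0 := by
  refine hom_ext fun c => ?_
  by_cases h : i ∈ c.2 <;> simp [h]

/-- The signed contractions anticommute: `face i ∘ face j = - face j ∘ face i` for `i ≠ j`.
[folklore] -/
theorem face_mul_face_of_ne {i j : Fin n} (hij : i ≠ j) :
    face N n R i * face N n R j = -(face N n R j * face N n R i) := by
  refine hom_ext fun c => ?_
  obtain ⟨v, S⟩ := c
  by_cases hi : i ∈ S
  · by_cases hj : j ∈ S
    · have hi' : i ∈ S.erase j := Finset.mem_erase.2 ⟨hij, hi⟩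
      have hj' : j ∈ S.erase i := Finset.mem_erase.2 ⟨hij.symm, hj⟩
      simp only [Module.End.mul_apply, LinearMap.neg_apply, face_single, hi, hj, if_true, hi', hj',
        Finset.erase_right_comm (a := j) (b := i), mul_one, ← Pi.single_neg]
      congr 1
      rcases lt_or_gt_of_ne hij with h | h
      · rw [sgn_erase_of_not_lt (not_lt.2 h.le), sgn_erase_of_lt hi h]
        ring
      · rw [sgn_erase_of_lt hj h, sgn_erase_of_not_lt (not_lt.2 h.le)]
        ring
    · simp [hi, hj]
  · by_cases hj : j ∈ S
    · simp [hi, hj]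
    · simp [hi, hj]

/-- Translations commute with the signed contractions. [folklore] -/
theorem shift_mul_face (i j : Fin n) :
    shift N n R i * face N n R j = face N n R j * shift N n R i := by
  refine hom_ext fun c => ?_
  by_cases hj : j ∈ c.2 <;> simp [hj]

/-- Translations commute. [folklore] -/
theorem shift_mul_shift (i j : Fin n) :
    shift N n R i * shift N n R j = shift N n R j * shift N n R i := by
  refine hom_ext fun c => ?_
  simp [add_right_comm]

/-- `∂ᵢ ∘ ∂ⱼ = (Tᵢ - 1)(Tⱼ - 1) ∘ (face i ∘ face j)`. [folklore] -/
theorem dOp_mul_dOp (i j : Fin n) :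
    dOp N n R i * dOp N n R j =
      (shift N n R i - 1) * (shift N n R j - 1) * (face N n R i * face N n R j) := by
  have h : face N n R i * (shift N n R j - 1) = (shift N n R j - 1) * face N n R i := by
    rw [mul_sub, sub_mul, mul_one, one_mul, shift_mul_face]
  simp only [dOp]
  rw [mul_assoc, ← mul_assoc (face N n R i), h]
  simp only [mul_assoc]

/-- `(Tᵢ - 1)` and `(Tⱼ - 1)` commute. [folklore] -/
theorem shift_sub_one_comm (i j : Fin n) :
    (shift N n R i - 1) * (shift N n R j - 1) = (shift N n R j - 1) * (shift N n R i - 1) := by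
  simp only [mul_sub, sub_mul, mul_one, one_mul, shift_mul_shift (R := R) i j]
  abel

/-- `∂ᵢ ∘ ∂ᵢ = 0`. [folklore] -/
theorem dOp_mul_self (i : Fin n) : dOp N n R i * dOp N n R i = 0 := by
  rw [dOp_mul_dOp, face_mul_face_self, mul_zero]

/-- `∂ᵢ ∘ ∂ⱼ + ∂ⱼ ∘ ∂ᵢ = 0` for `i ≠ j`. [folklore] -/
theorem dOp_mul_dOp_add {i j : Fin n} (hij : i ≠ j) :
    dOp N n R i * dOp N n R j + dOp N n R j * dOp N n R i = 0 := by
  rw [dOp_mul_dOp, dOp_mul_dOp, shift_sub_one_comm (R := R) j i, ← mul_add,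
    face_mul_face_of_ne hij, neg_add_cancel, mul_zero]

/-- **`∂ ∘ ∂ = 0`**: the cellular boundary of the cubical torus squares to zero.
[cite: HatcherAT2002, §2.2 (cellular chain complex)] -/
theorem boundary_mul_boundary : boundary N n R * boundary N n R = 0 := by
  rw [boundary_eq_sum_dOp, Finset.sum_mul_sum, ← Finset.sum_product', ← Finset.diag_union_offDiag,
    Finset.sum_union (Finset.disjoint_diag_offDiag _), Finset.sum_diag]
  have h1 : ∑ i : Fin n, dOp N n R i * dOp N n R i = 0 :=
    Finset.sum_eq_zero fun i _ => dOp_mul_self i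
  have h2 : ∑ p ∈ (Finset.univ : Finset (Fin n)).offDiag, dOp N n R p.1 * dOp N n R p.2 = 0 := by
    refine Finset.sum_involution (fun p _ => p.swap) ?_ ?_ ?_ ?_
    · intro p hp
      exact dOp_mul_dOp_add (Finset.mem_offDiag.1 hp).2.2
    · intro p hp _ h
      have h' : p.2 = p.1 := congrArg Prod.fst h
      exact (Finset.mem_offDiag.1 hp).2.2 h'.symm
    · intro p hp
      simp only [Finset.mem_offDiag, Finset.mem_univ, true_and] at hp ⊢
      exact fun h => hp h.symm
    · intro p _
      rfl
  rw [h1, h2, add_zero]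

/-- `∂ (∂ x) = 0`. [cite: HatcherAT2002, §2.2 (cellular chain complex)] -/
@[simp] theorem boundary_boundary (x : Chain N n R) : boundary N n R (boundary N n R x) = 0 := by
  rw [← Module.End.mul_apply, boundary_mul_boundary, LinearMap.zero_apply]

/-! ### Incidence numbers -/

/-- The coefficient of a non-facet in the boundary of a cell vanishes. [folklore] -/
theorem boundary_single_apply_eq_zero {c c' : Cell N n} (h : c' ∉ c.facets) :
    boundary N n R (Pi.single c 1) c' = 0 := by
  rw [boundary_single, cellBoundary_eq, Finset.sum_apply]
  refine Finset.sum_eq_zero fun i hi => ?_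
  have hf : c' ≠ c.front i := fun h' => h (h' ▸ c.front_mem_facets hi)
  have hb : c' ≠ c.back i := fun h' => h (h' ▸ c.back_mem_facets hi)
  simp [hf, hb]

/-- For `1 < N`, the coefficient of the back face `(v, S ∖ i)` in `∂ (v, S)` is
`-(-1)^{below S i}`. [cite: HatcherAT2002, §3.B Prop. 3B.1] -/
theorem boundary_single_apply_back [Fact (1 < N)] (c : Cell N n) {i : Fin n} (hi : i ∈ c.2) :
    boundary N n R (Pi.single c 1) (c.back i) = -sgn R c.2 i := by
  rw [boundary_single, cellBoundary_eq, Finset.sum_apply, Finset.sum_eq_single i]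
  · have hf : c.back i ≠ c.front i := c.back_ne_front i i hi
    simp [hf]
  · intro j hj hji
    have hf : c.back i ≠ c.front j := c.back_ne_front i j hi
    have hb : c.back i ≠ c.back j := fun h => hji ((c.back_eq_back_iff hi).1 h).symm
    simp [hf, hb]
  · exact fun h => absurd hi h

/-- For `1 < N`, the coefficient of the front face `(v + eᵢ, S ∖ i)` in `∂ (v, S)` is
`(-1)^{below S i}`. [cite: HatcherAT2002, §3.B Prop. 3B.1] -/
theorem boundary_single_apply_front [Fact (1 < N)] (c : Cell N n) {i : Fin n} (hi : i ∈ c.2) :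
    boundary N n R (Pi.single c 1) (c.front i) = sgn R c.2 i := by
  rw [boundary_single, cellBoundary_eq, Finset.sum_apply, Finset.sum_eq_single i]
  · have hb : c.front i ≠ c.back i := (c.back_ne_front i i hi).symm
    simp [hb]
  · intro j hj hji
    have hf : c.front i ≠ c.front j := fun h => hji ((c.front_eq_front_iff hi).1 h).symm
    have hb : c.front i ≠ c.back j := (c.back_ne_front j i hj).symm
    simp [hf, hb]
  · exact fun h => absurd hi h

/-! ### The grading -/

variable (N n R) in
/-- The **`k`-chains**: the chains supported on the cells of dimension `k`.
[cite: HatcherAT2002, §2.2 (cellular chain complex)] -/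
def degree (k : ℕ) : Submodule R (Chain N n R) where
  carrier := {x | ∀ c, x c ≠ 0 → c.dim = k}
  add_mem' {x y} hx hy c hc := by
    by_contra h
    have hx' : x c = 0 := not_imp_comm.1 (hx c) h
    have hy' : y c = 0 := not_imp_comm.1 (hy c) h
    exact hc (by simp [hx', hy'])
  zero_mem' c hc := absurd rfl hc
  smul_mem' r x hx c hc := hx c fun h => hc (by simp [h])

omit [NeZero N] in
/-- Membership in `degree k`: the chain vanishes off the `k`-cells. [folklore] -/
theorem mem_degree_iff {x : Chain N n R} {k : ℕ} :
    x ∈ degree N n R k ↔ ∀ c, x c ≠ 0 → c.dim = k :=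
  Iff.rfl

omit [NeZero N] in
/-- A `k`-cell is a `k`-chain. [folklore] -/
theorem single_mem_degree {c : Cell N n} {k : ℕ} (h : c.dim = k) (r : R) :
    (Pi.single c r : Chain N n R) ∈ degree N n R k := by
  intro c' hc'
  by_cases hcc : c' = c
  · rw [hcc, h]
  · exact absurd (by simp [hcc]) hc'

/-- `degree k` is spanned by the `k`-cells. [folklore] -/
theorem degree_eq_span (k : ℕ) :
    degree N n R k =
      Submodule.span R ((fun c => (Pi.single c (1 : R) : Chain N n R)) '' {c | c.dim = k}) := by
  refine le_antisymm (fun x hx => ?_) ?_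
  · rw [← Finset.univ_sum_single x]
    refine Submodule.sum_mem _ fun c _ => ?_
    by_cases hc : x c = 0
    · rw [hc, Pi.single_zero]
      exact Submodule.zero_mem _
    · rw [← smul_single_one]
      exact Submodule.smul_mem _ _ (Submodule.subset_span ⟨c, hx c hc, rfl⟩)
  · rw [Submodule.span_le]
    rintro _ ⟨c, hc, rfl⟩
    exact single_mem_degree hc 1

/-- A linear map sends the `k`-chains into `P` as soon as it sends the `k`-cells into `P`.
[folklore] -/
theorem map_degree_le {M : Type*} [AddCommGroup M] [Module R M] {f : Chain N n R →ₗ[R] M}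
    {k : ℕ} {P : Submodule R M}
    (h : ∀ c : Cell N n, c.dim = k → f (Pi.single c 1) ∈ P) :
    (degree N n R k).map f ≤ P := by
  rw [degree_eq_span, Submodule.map_span_le]
  rintro _ ⟨c, hc, rfl⟩
  exact h c hc

/-- Elementwise form of `map_degree_le`. [folklore] -/
theorem apply_mem_of_mem_degree {M : Type*} [AddCommGroup M] [Module R M]
    {f : Chain N n R →ₗ[R] M} {k : ℕ} {P : Submodule R M}
    (h : ∀ c : Cell N n, c.dim = k → f (Pi.single c 1) ∈ P) {x : Chain N n R}
    (hx : x ∈ degree N n R k) : f x ∈ P :=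
  map_degree_le h (Submodule.mem_map_of_mem hx)

omit [NeZero N] in
/-- The boundary of a `(k+1)`-cell is a `k`-chain. [folklore] -/
theorem cellBoundary_mem_degree {c : Cell N n} {k : ℕ} (h : c.dim = k + 1) :
    cellBoundary R c ∈ degree N n R k := by
  refine Submodule.sum_mem _ fun i hi => Submodule.smul_mem _ _ (Submodule.sub_mem _ ?_ ?_)
  · exact single_mem_degree (by have := c.dim_front_add_one hi; omega) 1
  · exact single_mem_degree (by have := c.dim_back_add_one hi; omega) 1

/-- **The boundary lowers the degree by one.** [cite: HatcherAT2002, §2.2] -/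
theorem boundary_mem_degree {k : ℕ} {x : Chain N n R} (hx : x ∈ degree N n R (k + 1)) :
    boundary N n R x ∈ degree N n R k :=
  apply_mem_of_mem_degree (fun c hc => by rw [boundary_single]; exact cellBoundary_mem_degree hc) hx

/-- The boundary vanishes on `0`-chains. [folklore] -/
theorem boundary_eq_zero_of_mem_degree_zero {x : Chain N n R} (hx : x ∈ degree N n R 0) :
    boundary N n R x = 0 := by
  have h := apply_mem_of_mem_degree (P := ⊥) (f := boundary N n R) (k := 0) (fun c hc => ?_) hx
  · simpa using h
  · have h0 : c.2 = ∅ := Finset.card_eq_zero.1 hc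
    rw [boundary_single, cellBoundary, h0, Finset.sum_empty]
    exact Submodule.zero_mem _

variable (N n R) in
/-- The graded piece `∂_k : C_{k+1} → C_k` of the boundary. [cite: HatcherAT2002, §2.2] -/
def boundaryMap (k : ℕ) : degree N n R (k + 1) →ₗ[R] degree N n R k :=
  (boundary N n R).restrict fun _ hx => boundary_mem_degree hx

/-- `boundaryMap` is the boundary. [folklore] -/
@[simp] theorem coe_boundaryMap (k : ℕ) (x : degree N n R (k + 1)) :
    (boundaryMap N n R k x : Chain N n R) = boundary N n R x := rfl

/-- `∂_k ∘ ∂_{k+1} = 0`. [cite: HatcherAT2002, §2.2] -/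
theorem boundaryMap_comp (k : ℕ) : boundaryMap N n R k ∘ₗ boundaryMap N n R (k + 1) = 0 := by
  ext x : 2
  simp

variable (N n R) in
/-- The **cellular chain complex of the cubical torus `(ℤ/N)^n`** over `R`, as an `ℕ`-graded chain
complex of `R`-modules: `C_k = degree N n R k`, `d_k = boundaryMap N n R k`.
[cite: HatcherAT2002, §2.2 and §3.B Prop. 3B.1] -/
def cubicalTorusComplex : ChainComplex (ModuleCat R) ℕ :=
  ChainComplex.of (fun k => ModuleCat.of R (degree N n R k))
    (fun k => ModuleCat.ofHom (boundaryMap N n R k)) fun k => by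
      ext1
      rw [ModuleCat.hom_comp, ModuleCat.hom_ofHom, ModuleCat.hom_ofHom, boundaryMap_comp]
      rfl

/-! ### Cycles, boundaries, homology, Betti numbers -/

variable (N n R) in
/-- The `k`-cycles `Z_k = ker ∂ ∩ C_k`. [cite: HatcherAT2002, §2.2] -/
def cycles (k : ℕ) : Submodule R (Chain N n R) := LinearMap.ker (boundary N n R) ⊓ degree N n R k

variable (N n R) in
/-- The `k`-boundaries `B_k = ∂ C_{k+1}`. [cite: HatcherAT2002, §2.2] -/
def boundaries (k : ℕ) : Submodule R (Chain N n R) := (degree N n R (k + 1)).map (boundary N n R)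

/-- Membership in the cycles. [folklore] -/
theorem mem_cycles_iff {k : ℕ} {x : Chain N n R} :
    x ∈ cycles N n R k ↔ boundary N n R x = 0 ∧ x ∈ degree N n R k := by
  simp [cycles]

/-- `B_k ≤ Z_k`. [cite: HatcherAT2002, §2.2] -/
theorem boundaries_le_cycles (k : ℕ) : boundaries N n R k ≤ cycles N n R k := by
  rintro _ ⟨x, hx, rfl⟩
  exact ⟨LinearMap.mem_ker.2 (boundary_boundary x), boundary_mem_degree hx⟩

variable (N n R) in
/-- The **`k`-th cellular homology** `H_k = Z_k / B_k` of the cubical torus `(ℤ/N)^n` with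
coefficients in `R` (the boundaries viewed inside the cycles). [cite: HatcherAT2002, §2.2] -/
abbrev homology (k : ℕ) : Type _ :=
  cycles N n R k ⧸ (boundaries N n R k).comap (cycles N n R k).subtype

variable (N n R) in
/-- The **`k`-th Betti number** of the cubical torus over `R`: the rank of `H_k`
(`= n.choose k` for every nontrivial `R`, see `CubicalTorusHomology.lean`).
[cite: HatcherAT2002, §3.3 p. 230] -/
def bettiNumber (k : ℕ) : ℕ := Module.finrank R (homology N n R k)

/-! ### Counting cells -/

omit [NeZero N] in
/-- The `k`-cells are the pairs (vertex, `k`-set of directions). [folklore] -/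
theorem filter_dim_eq [Fintype (Fin n → ZMod N)] (k : ℕ) :
    (Finset.univ.filter fun c : Cell N n => c.dim = k) =
      (Finset.univ : Finset (Fin n → ZMod N)) ×ˢ Finset.univ.powersetCard k := by
  ext ⟨v, S⟩
  simp [Cell.dim, Finset.mem_powersetCard]

/-- The number of `k`-cells of the cubical torus `(ℤ/N)^n` is `N^n · C(n, k)`. [folklore] -/
theorem card_filter_dim_eq (k : ℕ) :
    (Finset.univ.filter fun c : Cell N n => c.dim = k).card = N ^ n * n.choose k := by
  rw [filter_dim_eq, Finset.card_product, Finset.card_powersetCard, Finset.card_univ,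
    Finset.card_univ, Fintype.card_pi, Fintype.card_fin]
  simp [ZMod.card]

/-- The number of `k`-cells, as the cardinality of a subtype. [folklore] -/
theorem card_subtype_dim_eq (k : ℕ) :
    Fintype.card {c : Cell N n // c.dim = k} = N ^ n * n.choose k := by
  rw [Fintype.card_subtype, card_filter_dim_eq]

end Ring

end CubicalTorus

end Literature.AlgebraicTopology.CellComplexes
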